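import Mathlib.Analysis.Calculus.UniformLimitsDeriv
import Mathlib.Analysis.Calculus.ContDiff.Basic
import Mathlib.Analysis.Normed.Group.FunctionSeries
import Mathlib.Topology.UniformSpace.UniformApproximation
import HarnessLib

/-!
# `Cⁿ` limits: sequences whose derivatives of orders `≤ n` are locally uniformly Cauchy

Analysis/FunctionSpaces support file (everything proved). The classical statement (Rudin,
*Principles of Mathematical Analysis*, Thm. 7.17, iterated; Dieudonné, *Foundations of Modern
Analysis*, (8.6.3)–(8.6.4)): if `f_j : P → F` are `Cⁿ` on an open set `U` (`F` complete),
`f_j → g` pointwise on `U`, and for every `i ≤ n` the derivatives `D^i f_j` form a locally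
uniformly Cauchy sequence on `U`, then `g` is `Cⁿ` on `U` and `D^i f_j → D^i g` locally
uniformly on `U` for every `i ≤ n` (`contDiffOn_of_uniformCauchySeqOn_iteratedFDeriv`,
`tendstoLocallyUniformlyOn_iteratedFDeriv_of_uniformCauchySeqOn`; the `C^∞` form
`contDiffOn_infty_of_uniformCauchySeqOn_iteratedFDeriv`). Mathlib has the order-one statement
in the form "derivative of the locally uniform limit" (`hasFDerivAt_of_tendstoLocallyUniformlyOn`);
this file iterates it through the currying isometries `iteratedFDeriv_succ_eq_comp_left` /
`fderiv_iteratedFDeriv`. Also recorded: the geometric/summable-increment criterion for uniform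
Cauchy sequences (`uniformCauchySeqOn_of_norm_sub_succ_le`), the form in which Picard iterates
come.

This is how the local smooth solution of the Navier–Stokes integral equation is obtained from
its Picard iterates with all their derivatives under control (Koch–Nadirashvili–Seregin–Šverák
2009, Prop. 4.1: the fixed point in the spaces normed by `‖t^{k/2+l}∇ᵏ∂ₜˡu‖_∞`).

## References

* W. Rudin, *Principles of Mathematical Analysis*, 3rd ed. (1976), Thm. 7.17.
* J. Dieudonné, *Foundations of Modern Analysis* (1960), (8.6.3)–(8.6.4).
-/

noncomputable section

open Set Filter Topology Function Metric
open scoped ContDiff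

namespace Literature.Analysis.FunctionSpaces

/-! ### Locally uniformly Cauchy sequences -/

section Cauchy

variable {P : Type*} [TopologicalSpace P] {U : Set P}

/-- A sequence which is uniformly Cauchy near every point of an open set and converges pointwise
there converges locally uniformly on the set. [folklore] -/
theorem tendstoLocallyUniformlyOn_of_forall_exists_uniformCauchySeqOn {G : Type*} [UniformSpace G]
    {ι : Type*} {l : Filter ι} (hU : IsOpen U) {H : ι → P → G} {h : P → G}
    (hC : ∀ x ∈ U, ∃ V ∈ 𝓝 x, UniformCauchySeqOn H l V)
    (hh : ∀ x ∈ U, Tendsto (fun j => H j x) l (𝓝 (h x))) :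
    TendstoLocallyUniformlyOn H h l U := by
  intro u hu x hx
  obtain ⟨V, hV, hVC⟩ := hC x hx
  refine ⟨V ∩ U, mem_nhdsWithin_of_mem_nhds (inter_mem hV (hU.mem_nhds hx)), ?_⟩
  exact ((hVC.mono inter_subset_left).tendstoUniformlyOn_of_tendsto fun y hy => hh y hy.2) u hu

/-- A sequence which is uniformly Cauchy near every point of a set, with values in a complete
normed group, has a pointwise limit on the set. [folklore] -/
theorem exists_tendsto_of_forall_exists_uniformCauchySeqOn {G : Type*} [NormedAddCommGroup G]
    [CompleteSpace G] {H : ℕ → P → G}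
    (hC : ∀ x ∈ U, ∃ V ∈ 𝓝 x, UniformCauchySeqOn H atTop V) :
    ∃ h : P → G, ∀ x ∈ U, Tendsto (fun j => H j x) atTop (𝓝 (h x)) := by
  classical
  have hpt : ∀ x ∈ U, ∃ y : G, Tendsto (fun j => H j x) atTop (𝓝 y) := fun x hx => by
    obtain ⟨V, hV, hVC⟩ := hC x hx
    exact cauchySeq_tendsto_of_complete (hVC.cauchySeq (mem_of_mem_nhds hV))
  choose! h hh using hpt
  exact ⟨h, hh⟩

/-- **Summable increments give a uniformly Cauchy sequence**: if `‖F_{j+1} - F_j‖ ≤ a_j` on `V`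
with `∑ a_j < ∞` (e.g. the geometric bounds of a Picard iteration), then `(F_j)` is uniformly
Cauchy on `V`. [folklore] -/
theorem uniformCauchySeqOn_of_norm_sub_succ_le {X G : Type*} [NormedAddCommGroup G] [CompleteSpace G]
    {F : ℕ → X → G} {V : Set X} {a : ℕ → ℝ} (ha : Summable a)
    (hF : ∀ j, ∀ x ∈ V, ‖F (j + 1) x - F j x‖ ≤ a j) : UniformCauchySeqOn F atTop V := by
  have ht := tendstoUniformlyOn_tsum_nat (f := fun j x => F (j + 1) x - F j x) ha
    (s := V) fun j x hx => hF j x hx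
  have h0 : TendstoUniformlyOn (fun _ : ℕ => F 0) (F 0) atTop V :=
    fun u hu => Eventually.of_forall fun _ _ _ => refl_mem_uniformity hu
  have hsum := h0.add ht
  have heq : ∀ N, EqOn ((fun _ : ℕ => F 0) N + fun x => ∑ n ∈ Finset.range N, (F (n + 1) x - F n x))
      (F N) V := by
    intro N x _
    simp only [Pi.add_apply]
    rw [Finset.sum_range_sub (fun n => F n x) N]
    abel
  exact (hsum.congr (Eventually.of_forall heq)).uniformCauchySeqOn

end Cauchy

/-! ### Derivatives of locally uniform limits, iterated -/

section Iterated

variable {P : Type*} [NormedAddCommGroup P] [NormedSpace ℝ P]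
  {F : Type*} [NormedAddCommGroup F] [NormedSpace ℝ F] [CompleteSpace F]
  {U : Set P} {f : ℕ → P → F} {g : P → F}

/-- **One step**: if `D^i f_j → D^i g` locally uniformly on the open set `U`, the `D^i f_j` are
differentiable on `U`, and `(D^{i+1} f_j)_j` is uniformly Cauchy near every point of `U`, then
`D^i g` is differentiable on `U` and `D^{i+1} f_j → D^{i+1} g` locally uniformly on `U`
(`hasFDerivAt_of_tendstoLocallyUniformlyOn` transported through the currying isometry).
(Rudin, Thm. 7.17.) [folklore] -/
theorem tendstoLocallyUniformlyOn_iteratedFDeriv_succ (hU : IsOpen U) {i : ℕ}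
    (hdiff : ∀ j, DifferentiableOn ℝ (iteratedFDeriv ℝ i (f j)) U)
    (hi : TendstoLocallyUniformlyOn (fun j => iteratedFDeriv ℝ i (f j)) (iteratedFDeriv ℝ i g) atTop U)
    (hC : ∀ x ∈ U, ∃ V ∈ 𝓝 x,
      UniformCauchySeqOn (fun j => iteratedFDeriv ℝ (i + 1) (f j)) atTop V) :
    DifferentiableOn ℝ (iteratedFDeriv ℝ i g) U ∧
      TendstoLocallyUniformlyOn (fun j => iteratedFDeriv ℝ (i + 1) (f j)) (iteratedFDeriv ℝ (i + 1) g)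
        atTop U := by
  -- the derivative sequence `fderiv (D^i f_j) = L ∘ D^{i+1} f_j` is locally uniformly Cauchy
  have hfd : ∀ j, fderiv ℝ (iteratedFDeriv ℝ i (f j)) =
      ⇑(continuousMultilinearCurryLeftEquiv ℝ (fun _ : Fin (i + 1) => P) F) ∘
        iteratedFDeriv ℝ (i + 1) (f j) := fun j => fderiv_iteratedFDeriv
  have hC' : ∀ x ∈ U, ∃ V ∈ 𝓝 x,
      UniformCauchySeqOn (fun j => fderiv ℝ (iteratedFDeriv ℝ i (f j))) atTop V := by
    intro x hx
    obtain ⟨V, hV, hVC⟩ := hC x hx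
    refine ⟨V, hV, ?_⟩
    have hfd' : (fun j => fderiv ℝ (iteratedFDeriv ℝ i (f j))) = fun j =>
        ⇑(continuousMultilinearCurryLeftEquiv ℝ (fun _ : Fin (i + 1) => P) F) ∘
          iteratedFDeriv ℝ (i + 1) (f j) := funext hfd
    rw [hfd']
    exact (continuousMultilinearCurryLeftEquiv ℝ (fun _ : Fin (i + 1) => P) F).lipschitz.uniformContinuous.comp_uniformCauchySeqOn
      hVC
  -- its locally uniform limit `h'`, the derivative of `D^i g`
  obtain ⟨h', hh'⟩ := exists_tendsto_of_forall_exists_uniformCauchySeqOn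
    (G := P →L[ℝ] ContinuousMultilinearMap ℝ (fun _ : Fin i => P) F) hC'
  have hTLU' : TendstoLocallyUniformlyOn (fun j => fderiv ℝ (iteratedFDeriv ℝ i (f j))) h' atTop U :=
    tendstoLocallyUniformlyOn_of_forall_exists_uniformCauchySeqOn hU hC' hh'
  have hderiv : ∀ x ∈ U, HasFDerivAt (iteratedFDeriv ℝ i g) (h' x) x := fun x hx =>
    hasFDerivAt_of_tendstoLocallyUniformlyOn hU hTLU'
      (fun j y hy => ((hdiff j).differentiableAt (hU.mem_nhds hy)).hasFDerivAt)
      (fun y hy => hi.tendsto_at hy) hx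
  refine ⟨fun x hx => (hderiv x hx).differentiableAt.differentiableWithinAt, ?_⟩
  -- transport back through the inverse currying isometry
  have h1 : TendstoLocallyUniformlyOn
      (fun j => ⇑(continuousMultilinearCurryLeftEquiv ℝ (fun _ : Fin (i + 1) => P) F).symm ∘
        fderiv ℝ (iteratedFDeriv ℝ i (f j)))
      (⇑(continuousMultilinearCurryLeftEquiv ℝ (fun _ : Fin (i + 1) => P) F).symm ∘ h') atTop U :=
    (continuousMultilinearCurryLeftEquiv ℝ (fun _ : Fin (i + 1) => P) F).symm.lipschitz.uniformContinuous.comp_tendstoLocallyUniformlyOn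
      hTLU'
  have h2 : ∀ j, ⇑(continuousMultilinearCurryLeftEquiv ℝ (fun _ : Fin (i + 1) => P) F).symm ∘
      fderiv ℝ (iteratedFDeriv ℝ i (f j)) = iteratedFDeriv ℝ (i + 1) (f j) := fun j => by
    rw [iteratedFDeriv_succ_eq_comp_left]
  refine (h1.congr fun j x _ => by rw [h2 j]).congr_right fun x hx => ?_
  change (continuousMultilinearCurryLeftEquiv ℝ (fun _ : Fin (i + 1) => P) F).symm (h' x) =
    iteratedFDeriv ℝ (i + 1) g x
  rw [iteratedFDeriv_succ_eq_comp_left, comp_apply, (hderiv x hx).fderiv]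

/-- **Locally uniform convergence of all derivatives up to order `n`**: if the `f_j` are `Cⁿ` on
the open set `U`, `f_j → g` pointwise on `U`, and for each `i ≤ n` the sequence `(D^i f_j)_j` is
uniformly Cauchy near every point of `U`, then `D^i f_j → D^i g` locally uniformly on `U` for
every `i ≤ n`, and `D^i g` is differentiable on `U` for `i < n`. (Rudin, Thm. 7.17, iterated.)
[folklore] -/
theorem tendstoLocallyUniformlyOn_iteratedFDeriv_of_uniformCauchySeqOn (hU : IsOpen U) {n : ℕ}
    (hf : ∀ j, ContDiffOn ℝ n (f j) U) (hfg : ∀ x ∈ U, Tendsto (fun j => f j x) atTop (𝓝 (g x)))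
    (hC : ∀ i ≤ n, ∀ x ∈ U, ∃ V ∈ 𝓝 x,
      UniformCauchySeqOn (fun j => iteratedFDeriv ℝ i (f j)) atTop V)
    {i : ℕ} (hi : i ≤ n) :
    TendstoLocallyUniformlyOn (fun j => iteratedFDeriv ℝ i (f j)) (iteratedFDeriv ℝ i g) atTop U ∧
      (i < n → DifferentiableOn ℝ (iteratedFDeriv ℝ i g) U) := by
  -- differentiability of the derivatives of the `f_j` of orders `< n`
  have hdiff : ∀ k < n, ∀ j, DifferentiableOn ℝ (iteratedFDeriv ℝ k (f j)) U := fun k hk j =>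
    ((hf j).differentiableOn_iteratedFDerivWithin (by exact_mod_cast hk) hU.uniqueDiffOn).congr
      fun y hy => (iteratedFDerivWithin_of_isOpen k hU hy).symm
  -- locally uniform convergence by induction on the order
  have hTLU : ∀ k ≤ n, TendstoLocallyUniformlyOn (fun j => iteratedFDeriv ℝ k (f j))
      (iteratedFDeriv ℝ k g) atTop U := by
    intro k
    induction k with
    | zero =>
      intro _
      refine tendstoLocallyUniformlyOn_of_forall_exists_uniformCauchySeqOn hU (hC 0 (Nat.zero_le _)) ?_
      intro x hx
      simp only [iteratedFDeriv_zero_eq_comp, comp_apply]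
      exact ((continuousMultilinearCurryFin0 ℝ P F).symm.continuous.tendsto _).comp (hfg x hx)
    | succ k IH =>
      intro hk
      exact (tendstoLocallyUniformlyOn_iteratedFDeriv_succ hU (hdiff k (by omega)) (IH (by omega))
        (hC (k + 1) hk)).2
  exact ⟨hTLU i hi, fun hin =>
    (tendstoLocallyUniformlyOn_iteratedFDeriv_succ hU (hdiff i hin) (hTLU i hi) (hC (i + 1) (by omega))).1⟩

/-- **`Cⁿ` limit theorem**: if the `f_j` are `Cⁿ` on the open set `U`, `f_j → g` pointwise on
`U`, and for each `i ≤ n` the sequence `(D^i f_j)_j` is uniformly Cauchy near every point of `U`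
(values in a complete space), then `g` is `Cⁿ` on `U`. (Rudin, Thm. 7.17, iterated; Dieudonné
(8.6.3).) [folklore] -/
theorem contDiffOn_of_uniformCauchySeqOn_iteratedFDeriv (hU : IsOpen U) {n : ℕ}
    (hf : ∀ j, ContDiffOn ℝ n (f j) U) (hfg : ∀ x ∈ U, Tendsto (fun j => f j x) atTop (𝓝 (g x)))
    (hC : ∀ i ≤ n, ∀ x ∈ U, ∃ V ∈ 𝓝 x,
      UniformCauchySeqOn (fun j => iteratedFDeriv ℝ i (f j)) atTop V) :
    ContDiffOn ℝ n g U := by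
  refine contDiffOn_of_continuousOn_differentiableOn (fun m hm => ?_) (fun m hm => ?_)
  · have hm' : m ≤ n := by exact_mod_cast hm
    have h := (tendstoLocallyUniformlyOn_iteratedFDeriv_of_uniformCauchySeqOn hU hf hfg hC hm').1
    have hc : ContinuousOn (iteratedFDeriv ℝ m g) U :=
      h.continuousOn (Eventually.of_forall fun j =>
        ((hf j).continuousOn_iteratedFDerivWithin (by exact_mod_cast hm') hU.uniqueDiffOn).congr
          fun y hy => (iteratedFDerivWithin_of_isOpen m hU hy).symm).frequently
    exact hc.congr fun y hy => iteratedFDerivWithin_of_isOpen m hU hy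
  · have hm' : m < n := by exact_mod_cast hm
    have h := (tendstoLocallyUniformlyOn_iteratedFDeriv_of_uniformCauchySeqOn hU hf hfg hC hm'.le).2 hm'
    exact h.congr fun y hy => iteratedFDerivWithin_of_isOpen m hU hy

/-- **`C^∞` limit theorem**: if the `f_j` are `C^∞` on the open set `U`, `f_j → g` pointwise on
`U`, and for every `i` the sequence `(D^i f_j)_j` is uniformly Cauchy near every point of `U`,
then `g` is `C^∞` on `U` and `D^i f_j → D^i g` locally uniformly on `U` for every `i`.
[folklore] -/
theorem contDiffOn_infty_of_uniformCauchySeqOn_iteratedFDeriv (hU : IsOpen U)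
    (hf : ∀ j, ContDiffOn ℝ ∞ (f j) U) (hfg : ∀ x ∈ U, Tendsto (fun j => f j x) atTop (𝓝 (g x)))
    (hC : ∀ i : ℕ, ∀ x ∈ U, ∃ V ∈ 𝓝 x,
      UniformCauchySeqOn (fun j => iteratedFDeriv ℝ i (f j)) atTop V) :
    ContDiffOn ℝ ∞ g U ∧
      ∀ i : ℕ, TendstoLocallyUniformlyOn (fun j => iteratedFDeriv ℝ i (f j)) (iteratedFDeriv ℝ i g)
        atTop U := by
  have hfn : ∀ n : ℕ, ∀ j, ContDiffOn ℝ n (f j) U := fun n j =>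
    (hf j).of_le (by exact_mod_cast le_top)
  refine ⟨contDiffOn_infty.2 fun n =>
    contDiffOn_of_uniformCauchySeqOn_iteratedFDeriv hU (hfn n) hfg fun i _ => hC i, fun i => ?_⟩
  exact (tendstoLocallyUniformlyOn_iteratedFDeriv_of_uniformCauchySeqOn hU (hfn i) hfg
    (fun k _ => hC k) le_rfl).1

end Iterated

end Literature.Analysis.FunctionSpaces

end
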